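import Summits.Ventures.HodgeRepro2.T5SU11JacobiPhaseLawInteger
import Summits.Ventures.HodgeRepro2.T5SU11JacobiMeanPhaseOutside
import Summits.Ventures.HodgeRepro2.T5SU11JacobiPhaseOrbitCovariance

/-!
# The phase moments at `λ = 4` in rational closed form: `⟨log|a|⟩_{k,4} = (k² − 8)/(k(k − 2)(k − 4))`,
`⟨(log|a|)²⟩_{k,4} = 2(k³ − 24k + 48)/(k(k − 2)²(k − 4)²)`, the variance, and the covariance with the orbit radius

At `λ = 4` the phase density is the signed mixture `2e^{−(k−4)s} − e^{−(k−2)s}` (`T5SU11JacobiPhaseLawInteger`), so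
every moment integral is a difference of two Euler integrals: `A_n := ∫_0^∞ sⁿ e^{−(k−2)s} Φ_4(s) ds
= 2 n!/(k − 4)^{n+1} − n!/(k − 2)^{n+1}` (`moment_four_eq`), and with `⟨(log|a|)ⁿ⟩ = A_n/A_0`
(`T5SU11JacobiMeanPhaseOutside.normalized_moment_eq_phase'`) and `A_0 = k/((k − 4)(k − 2))`:

* **`⟨log|a|⟩_{k,4} = (k² − 8)/(k(k − 2)(k − 4))`** (`mean_phase_four_eq`), so that
  `k(k ⟨log|a|⟩_{k,4} − 1) = k(6k − 16)/((k − 2)(k − 4)) → 6 = 2 + c'` with `c' = 4·2/2 = 4` (`mul_mul_mean_phase_four_sub_one_eq`)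
  — the exact form of `T5SU11JacobiMeanPhaseOutside.tendsto_mul_mul_mean_phase_sub_one_all` at `λ = 4`;
* **`⟨(log|a|)²⟩_{k,4} = 2(k³ − 24k + 48)/(k(k − 2)²(k − 4)²)`** (`second_moment_phase_four_eq`);
* the variance `Var_{k,4}(log|a|)` as the difference of the two closed forms (`variance_phase_four_eq`);
* the covariance with the squared orbit radius, `Cov_{k,4}(log|a|, |g·0|²) = r_k(4)(⟨log|a|⟩_{k,4} − ⟨log|a|⟩_{k+2,4})`
  with `r_k(4) = (k − 4)(k + 2)/k²`, through the two mean phases in closed form (`covariance_phase_orbit_sq_four_eq`).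

All for `k > 4` (the ray at `λ = 4`). At `λ = 6` (`k > 6`): `∫ sⁿ e^{−(k−2)s} Φ_6 = 6n!/(k − 6)^{n+1} − 6n!/(k − 4)^{n+1} + n!/(k − 2)^{n+1}`
(`moment_six_eq`), `m̂_k(6) = 2πk(k + 2)/((k − 6)(k − 4)(k − 2))` (`jacobi_six_eq'`) and
**`⟨log|a|⟩_{k,6} = (k⁴ + 4k³ − 68k² + 96k + 96)/(k(k + 2)(k − 6)(k − 4)(k − 2))`** (`mean_phase_six_eq`), whose next
term is `14 = 2 + 12`. Nothing is claimed about (N).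

Blind lane: Mathlib + the HodgeRepro2 prefix only; no sorry; axioms ⊆ {propext, Classical.choice,
Quot.sound}.
-/

namespace Summit.Ventures.HodgeRepro2.T5SU11JacobiPhaseMomentsFour

open MeasureTheory MeasureTheory.Measure Metric Set Filter Topology
open T5SU11Unimodular T5SU11Fibration T5SU11Cartan T5SU11OneParameter T5SU11CartanProjection T5HaarCircle
  T5BergmanCoefficient T5SU11FibrationHaar T5SU11SphericalFunction T5SU11SphericalSymmetry
  T5SU11SphericalBounds T5SU11SphericalContinuous T5SU11JacobiLaplacePhase T5SU11PhaseLawLintegral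
  T5SU11JacobiPhaseLawRate T5SU11JacobiMeanPhaseRate T5SU11JacobiMeanPhaseOutside T5SU11JacobiPhaseLawInteger
  T5SU11JacobiWeightRecursion T5SU11JacobiPhaseOrbitCovariance T5SU11JacobiWeight T5SU11KFiniteMajorantPow
open scoped Real

/-! ### Euler integrals against `e^{cs}` -/

/-- `∫_0^∞ sⁿ e^{−rs} e^{cs} ds = n!/(r − c)^{n+1}` for `r > c`. -/
theorem integral_pow_mul_exp_neg_mul_mul_exp_Ioi (n : ℕ) {r c : ℝ} (h : c < r) :
    ∫ s in Ioi (0 : ℝ), s ^ n * Real.exp (-(r * s)) * Real.exp (c * s) = (n.factorial : ℝ) / (r - c) ^ (n + 1) := by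
  rw [← integral_pow_mul_exp_neg_mul_Ioi n (by linarith : 0 < r - c)]
  refine setIntegral_congr_fun measurableSet_Ioi fun s _ => ?_
  rw [mul_assoc, ← Real.exp_add]
  ring_nf

/-- `sⁿ e^{−rs} e^{cs}` is integrable on `(0, ∞)` for `r > c`. -/
theorem integrableOn_pow_mul_exp_neg_mul_mul_exp_Ioi (n : ℕ) {r c : ℝ} (h : c < r) :
    IntegrableOn (fun s : ℝ => s ^ n * Real.exp (-(r * s)) * Real.exp (c * s)) (Ioi 0) := by
  refine (integrableOn_pow_mul_exp_neg_mul_Ioi' n (by linarith : 0 < r - c)).congr_fun (fun s _ => ?_)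
    measurableSet_Ioi
  rw [mul_assoc, ← Real.exp_add]
  ring_nf

section measure

variable [MeasurableSpace Circle] [BorelSpace Circle]

/-! ### The moment integrals at `λ = 4` -/

/-- **`A_n = ∫_0^∞ sⁿ e^{−(k−2)s} Φ_4(s) ds = 2 n!/(k − 4)^{n+1} − n!/(k − 2)^{n+1}`** for `k > 4`. -/
theorem moment_four_eq (n : ℕ) {k : ℝ} (hk : 4 < k) :
    ∫ s in Ioi (0 : ℝ), s ^ n * Real.exp (-((k - 2) * s)) * sphPhase 4 s
      = 2 * (n.factorial : ℝ) / (k - 4) ^ (n + 1) - (n.factorial : ℝ) / (k - 2) ^ (n + 1) := by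
  have e : ∫ s in Ioi (0 : ℝ), s ^ n * Real.exp (-((k - 2) * s)) * sphPhase 4 s
      = ∫ s in Ioi (0 : ℝ), (2 * (s ^ n * Real.exp (-((k - 2) * s)) * Real.exp (2 * s))
          - s ^ n * Real.exp (-((k - 2) * s))) := by
    refine setIntegral_congr_fun measurableSet_Ioi fun s hs => ?_
    rw [sphPhase_four (le_of_lt hs)]
    ring
  have i2 := (integrableOn_pow_mul_exp_neg_mul_mul_exp_Ioi n (r := k - 2) (c := 2) (by linarith)).const_mul 2
  have i0 : IntegrableOn (fun s : ℝ => s ^ n * Real.exp (-((k - 2) * s))) (Ioi 0) :=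
    integrableOn_pow_mul_exp_neg_mul_Ioi' n (by linarith : (0 : ℝ) < k - 2)
  rw [e, integral_sub i2 i0, integral_const_mul,
    integral_pow_mul_exp_neg_mul_mul_exp_Ioi n (r := k - 2) (c := 2) (by linarith),
    integral_pow_mul_exp_neg_mul_Ioi n (by linarith : (0 : ℝ) < k - 2)]
  ring_nf

/-- **`⟨log|a|⟩_{k,4} = (k² − 8)/(k(k − 2)(k − 4))`** for `k > 4`. -/
theorem mean_phase_four_eq {k : ℝ} (hk : 4 < k) :
    (∫ g, Real.log ‖mat g 0 0‖ * ((1 - ‖orbit g‖ ^ 2) ^ (k / 2) * sph 4 g) ∂(nu haarCircle))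
        / (∫ g, (1 - ‖orbit g‖ ^ 2) ^ (k / 2) * sph 4 g ∂(nu haarCircle))
      = (k ^ 2 - 8) / (k * (k - 2) * (k - 4)) := by
  have hm := normalized_moment_eq_phase' 1 (k := k) (lam := 4) (by linarith) hk (by linarith)
  have hA1 := moment_four_eq 1 hk
  have hA0 := moment_four_eq 0 hk
  simp only [pow_one, Nat.factorial_one, Nat.cast_one, Nat.reduceAdd] at hA1 hm
  simp only [pow_zero, one_mul, Nat.factorial_zero, Nat.cast_one, zero_add, pow_one] at hA0
  rw [hm, hA1, hA0]
  have h1 : k - 4 ≠ 0 := by linarith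
  have h2 : k - 2 ≠ 0 := by linarith
  have h3 : k ≠ 0 := by linarith
  have hD : 2 * 1 / (k - 4) - 1 / (k - 2) = k / ((k - 4) * (k - 2)) := by
    field_simp
    ring
  have hN : 2 * 1 / (k - 4) ^ 2 - 1 / (k - 2) ^ 2 = (k ^ 2 - 8) / ((k - 4) ^ 2 * (k - 2) ^ 2) := by
    field_simp
    ring
  rw [hN, hD, div_div_eq_mul_div, div_eq_div_iff h3 (mul_ne_zero (mul_ne_zero h3 h2) h1)]
  field_simp

/-- **The exact form of the next term at `λ = 4`**: `k(k ⟨log|a|⟩_{k,4} − 1) = k(6k − 16)/((k − 2)(k − 4))`, which tends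
to `6 = 2 + c'` (`c' = 4`). -/
theorem mul_mul_mean_phase_four_sub_one_eq {k : ℝ} (hk : 4 < k) :
    k * (k * ((∫ g, Real.log ‖mat g 0 0‖ * ((1 - ‖orbit g‖ ^ 2) ^ (k / 2) * sph 4 g) ∂(nu haarCircle))
        / (∫ g, (1 - ‖orbit g‖ ^ 2) ^ (k / 2) * sph 4 g ∂(nu haarCircle))) - 1)
      = k * (6 * k - 16) / ((k - 2) * (k - 4)) := by
  rw [mean_phase_four_eq hk]
  have h1 : k - 4 ≠ 0 := by linarith
  have h2 : k - 2 ≠ 0 := by linarith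
  have h3 : k ≠ 0 := by linarith
  field_simp
  ring

/-- **`⟨(log|a|)²⟩_{k,4} = 2(k³ − 24k + 48)/(k(k − 2)²(k − 4)²)`** for `k > 4`. -/
theorem second_moment_phase_four_eq {k : ℝ} (hk : 4 < k) :
    (∫ g, Real.log ‖mat g 0 0‖ ^ 2 * ((1 - ‖orbit g‖ ^ 2) ^ (k / 2) * sph 4 g) ∂(nu haarCircle))
        / (∫ g, (1 - ‖orbit g‖ ^ 2) ^ (k / 2) * sph 4 g ∂(nu haarCircle))
      = 2 * (k ^ 3 - 24 * k + 48) / (k * (k - 2) ^ 2 * (k - 4) ^ 2) := by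
  have hA2 := moment_four_eq 2 hk
  have hA0 := moment_four_eq 0 hk
  simp only [Nat.factorial_two, Nat.cast_ofNat, Nat.reduceAdd] at hA2
  simp only [pow_zero, one_mul, Nat.factorial_zero, Nat.cast_one, zero_add, pow_one] at hA0
  rw [normalized_moment_eq_phase' 2 (k := k) (lam := 4) (by linarith) hk (by linarith), hA2, hA0]
  have h1 : k - 4 ≠ 0 := by linarith
  have h2 : k - 2 ≠ 0 := by linarith
  have h3 : k ≠ 0 := by linarith
  have hD : 2 * 1 / (k - 4) - 1 / (k - 2) = k / ((k - 4) * (k - 2)) := by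
    field_simp
    ring
  have hN : 2 * 2 / (k - 4) ^ 3 - 2 / (k - 2) ^ 3
      = 2 * (k ^ 3 - 24 * k + 48) / ((k - 4) ^ 3 * (k - 2) ^ 3) := by
    field_simp
    ring
  rw [hN, hD, div_div_eq_mul_div,
    div_eq_div_iff h3 (mul_ne_zero (mul_ne_zero h3 (pow_ne_zero 2 h2)) (pow_ne_zero 2 h1))]
  field_simp

/-- **The variance at `λ = 4`** in closed form:
`Var_{k,4}(log|a|) = 2(k³ − 24k + 48)/(k(k − 2)²(k − 4)²) − ((k² − 8)/(k(k − 2)(k − 4)))²`. -/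
theorem variance_phase_four_eq {k : ℝ} (hk : 4 < k) :
    (∫ g, Real.log ‖mat g 0 0‖ ^ 2 * ((1 - ‖orbit g‖ ^ 2) ^ (k / 2) * sph 4 g) ∂(nu haarCircle))
        / (∫ g, (1 - ‖orbit g‖ ^ 2) ^ (k / 2) * sph 4 g ∂(nu haarCircle))
      - ((∫ g, Real.log ‖mat g 0 0‖ * ((1 - ‖orbit g‖ ^ 2) ^ (k / 2) * sph 4 g) ∂(nu haarCircle))
        / (∫ g, (1 - ‖orbit g‖ ^ 2) ^ (k / 2) * sph 4 g ∂(nu haarCircle))) ^ 2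
      = 2 * (k ^ 3 - 24 * k + 48) / (k * (k - 2) ^ 2 * (k - 4) ^ 2)
        - ((k ^ 2 - 8) / (k * (k - 2) * (k - 4))) ^ 2 := by
  rw [second_moment_phase_four_eq hk, mean_phase_four_eq hk]

/-- **The covariance of the phase and the squared orbit radius at `λ = 4`** in closed form:
`Cov_{k,4}(log|a|, |g·0|²) = ((k − 4)(k + 2)/k²)((k² − 8)/(k(k − 2)(k − 4)) − ((k + 2)² − 8)/((k + 2)k(k − 2)))`. -/
theorem covariance_phase_orbit_sq_four_eq {k : ℝ} (hk : 4 < k) :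
    (∫ g, Real.log ‖mat g 0 0‖ * ‖orbit g‖ ^ 2 * ((1 - ‖orbit g‖ ^ 2) ^ (k / 2) * sph 4 g)
          ∂(nu haarCircle))
        / (∫ g, (1 - ‖orbit g‖ ^ 2) ^ (k / 2) * sph 4 g ∂(nu haarCircle))
      - ((∫ g, Real.log ‖mat g 0 0‖ * ((1 - ‖orbit g‖ ^ 2) ^ (k / 2) * sph 4 g) ∂(nu haarCircle))
          / (∫ g, (1 - ‖orbit g‖ ^ 2) ^ (k / 2) * sph 4 g ∂(nu haarCircle)))
        * ((∫ g, ‖orbit g‖ ^ 2 * ((1 - ‖orbit g‖ ^ 2) ^ (k / 2) * sph 4 g) ∂(nu haarCircle))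
          / (∫ g, (1 - ‖orbit g‖ ^ 2) ^ (k / 2) * sph 4 g ∂(nu haarCircle)))
      = (k - 4) * (k + 2) / k ^ 2
        * ((k ^ 2 - 8) / (k * (k - 2) * (k - 4)) - ((k + 2) ^ 2 - 8) / ((k + 2) * (k + 2 - 2) * (k + 2 - 4))) := by
  rw [covariance_phase_orbit_sq_eq (by linarith) hk (by linarith), mean_phase_four_eq hk,
    mean_phase_four_eq (k := k + 2) (by linarith), weightRatio_eq (by linarith : k ≠ 0)]
  have h3 : k ≠ 0 := by linarith
  congr 1
  field_simp
  ring

/-! ### The moment integrals at `λ = 6` -/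

/-- **`∫_0^∞ sⁿ e^{−(k−2)s} Φ_6(s) ds = 6 n!/(k − 6)^{n+1} − 6 n!/(k − 4)^{n+1} + n!/(k − 2)^{n+1}`** for `k > 6`. -/
theorem moment_six_eq (n : ℕ) {k : ℝ} (hk : 6 < k) :
    ∫ s in Ioi (0 : ℝ), s ^ n * Real.exp (-((k - 2) * s)) * sphPhase 6 s
      = 6 * (n.factorial : ℝ) / (k - 6) ^ (n + 1) - 6 * (n.factorial : ℝ) / (k - 4) ^ (n + 1)
        + (n.factorial : ℝ) / (k - 2) ^ (n + 1) := by
  have e : ∫ s in Ioi (0 : ℝ), s ^ n * Real.exp (-((k - 2) * s)) * sphPhase 6 s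
      = ∫ s in Ioi (0 : ℝ), ((6 * (s ^ n * Real.exp (-((k - 2) * s)) * Real.exp (4 * s))
          - 6 * (s ^ n * Real.exp (-((k - 2) * s)) * Real.exp (2 * s))) + s ^ n * Real.exp (-((k - 2) * s))) := by
    refine setIntegral_congr_fun measurableSet_Ioi fun s hs => ?_
    rw [sphPhase_six (le_of_lt hs)]
    ring
  have i4 := (integrableOn_pow_mul_exp_neg_mul_mul_exp_Ioi n (r := k - 2) (c := 4) (by linarith)).const_mul 6
  have i2 := (integrableOn_pow_mul_exp_neg_mul_mul_exp_Ioi n (r := k - 2) (c := 2) (by linarith)).const_mul 6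
  have i0 : IntegrableOn (fun s : ℝ => s ^ n * Real.exp (-((k - 2) * s))) (Ioi 0) :=
    integrableOn_pow_mul_exp_neg_mul_Ioi' n (by linarith : (0 : ℝ) < k - 2)
  have i42 : IntegrableOn (fun s : ℝ => 6 * (s ^ n * Real.exp (-((k - 2) * s)) * Real.exp (4 * s))
      - 6 * (s ^ n * Real.exp (-((k - 2) * s)) * Real.exp (2 * s))) (Ioi 0) := i4.sub i2
  rw [e, integral_add i42 i0, integral_sub i4 i2, integral_const_mul, integral_const_mul,
    integral_pow_mul_exp_neg_mul_mul_exp_Ioi n (r := k - 2) (c := 4) (by linarith),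
    integral_pow_mul_exp_neg_mul_mul_exp_Ioi n (r := k - 2) (c := 2) (by linarith),
    integral_pow_mul_exp_neg_mul_Ioi n (by linarith : (0 : ℝ) < k - 2)]
  ring_nf

/-- **`m̂_k(6) = 2π k(k + 2)/((k − 6)(k − 4)(k − 2))`** for `k > 6` — the partial fractions of
`T5SU11JacobiPhaseLawInteger.jacobi_six_eq` recombined, in agreement with the recursion in the parameter
`m̂_k(6) = ((k + 2)/(k − 6)) m̂_k(4)`. -/
theorem jacobi_six_eq' {k : ℝ} (hk : 6 < k) :
    ∫ g, (1 - ‖orbit g‖ ^ 2) ^ (k / 2) * sph 6 g ∂(nu haarCircle)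
      = 2 * π * (k * (k + 2) / ((k - 6) * (k - 4) * (k - 2))) := by
  rw [jacobi_six_eq hk]
  have h1 : k - 6 ≠ 0 := by linarith
  have h2 : k - 4 ≠ 0 := by linarith
  have h3 : k - 2 ≠ 0 := by linarith
  congr 1
  field_simp
  ring

/-- **`⟨log|a|⟩_{k,6} = (k⁴ + 4k³ − 68k² + 96k + 96)/(k(k + 2)(k − 6)(k − 4)(k − 2))`** for `k > 6`; `k(k ⟨log|a|⟩ − 1) → 14 = 2 + c'`
with `c' = 6·4/2 = 12`. -/
theorem mean_phase_six_eq {k : ℝ} (hk : 6 < k) :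
    (∫ g, Real.log ‖mat g 0 0‖ * ((1 - ‖orbit g‖ ^ 2) ^ (k / 2) * sph 6 g) ∂(nu haarCircle))
        / (∫ g, (1 - ‖orbit g‖ ^ 2) ^ (k / 2) * sph 6 g ∂(nu haarCircle))
      = (k ^ 4 + 4 * k ^ 3 - 68 * k ^ 2 + 96 * k + 96) / (k * (k + 2) * (k - 6) * (k - 4) * (k - 2)) := by
  have hm := normalized_moment_eq_phase' 1 (k := k) (lam := 6) (by linarith) hk (by linarith)
  have hA1 := moment_six_eq 1 hk
  have hA0 := moment_six_eq 0 hk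
  simp only [pow_one, Nat.factorial_one, Nat.cast_one, Nat.reduceAdd] at hA1 hm
  simp only [pow_zero, one_mul, Nat.factorial_zero, Nat.cast_one, zero_add, pow_one] at hA0
  rw [hm, hA1, hA0]
  have h1 : k - 6 ≠ 0 := by linarith
  have h2 : k - 4 ≠ 0 := by linarith
  have h3 : k - 2 ≠ 0 := by linarith
  have h4 : k ≠ 0 := by linarith
  have h5 : k + 2 ≠ 0 := by linarith
  have hD : 6 * 1 / (k - 6) - 6 * 1 / (k - 4) + 1 / (k - 2) = k * (k + 2) / ((k - 6) * (k - 4) * (k - 2)) := by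
    field_simp
    ring
  have hN : 6 * 1 / (k - 6) ^ 2 - 6 * 1 / (k - 4) ^ 2 + 1 / (k - 2) ^ 2
      = (k ^ 4 + 4 * k ^ 3 - 68 * k ^ 2 + 96 * k + 96) / ((k - 6) ^ 2 * (k - 4) ^ 2 * (k - 2) ^ 2) := by
    field_simp
    ring
  rw [hN, hD, div_div_eq_mul_div,
    div_eq_div_iff (mul_ne_zero h4 h5) (mul_ne_zero (mul_ne_zero (mul_ne_zero (mul_ne_zero h4 h5) h1) h2) h3)]
  field_simp

end measure

end Summit.Ventures.HodgeRepro2.T5SU11JacobiPhaseMomentsFour
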